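import Summits.MatrixMultiplication.OmegaCensus.STPPVosperSlackTwoCheckersTP
import Summits.MatrixMultiplication.OmegaCensus.STPPVosperSlackTwoTablesZ59
import Summits.MatrixMultiplication.OmegaCensus.STPPVosperSlackTwoLawABQ

/-!
# ω-census (abelian STPP census): ℤ₅₉ leaf L3 — slack-2 three-block law, case C rows, part 26 (kernel computations)

HONEST FRAMING (pub-omega census; verbatim): lottery ticket; floor = certified bounds/negative ranges.
Census STRUCTURE (seat pub-omega-stpp-2 gen 27 — rows service for the stpp-1 lineage's law, 2026-08-29), family (b2).  Rows for stpp-1 g33's three-block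
slack-2 law, case C (checker `caseCDeadTP` of `STPPVosperSlackTwoCheckersTP.lean` — PRUNED tiling loop: a translate is entered only while |Yc| ≥ L, dead table `tblZ59L3C` of `…TablesZ59.lean`):
`caseCDeadTP 59 4 15 15 Q P h₀ tblZ59L3C = true` for `Q ∈ qShapesC 3`, `P ∈ pShapesC 59 2` (58 shapes `[0, d]`), `h₀ ∈ [1, 15]`.  Light `P`-ranges are one `decide` each;
heavy `P` (near-interval patterns) are split by `Q` and hole ranges and glued back in the same file (`List.all_append`); every `decide` ≤ 15000 mirror units
(HOME `pub-omega-stpp-2-g27/code/costT_perhole.py`, farm-calibrated), every file ≤ 60000 units.  Assembly in `STPPVosperSlackTwoRows59L3CAsm.lean`.  Nothing here is progress on `ω`.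
-/

namespace Summit.MatrixMultiplication.OmegaCensus.CubeNB.S2

/-- Case C rows, `P`-indices `[56, 58)` (all `Q`, all holes): one `decide`. [folklore] -/
theorem rows59L3C_r56_2 : ((((pShapesC 59 2).drop 56).take 2).all fun P => (qShapesC 3).all fun Q => (List.range' 1 15).all fun h₀ => caseCDeadTP 59 4 15 15 Q P h₀ tblZ59L3C) = true := by
  decide +kernel

end Summit.MatrixMultiplication.OmegaCensus.CubeNB.S2
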